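import Summits.QuantumFields.YangMills.Theorems.ColdStartUniversalityLatticeLangevinCorrectorIncrements
import Summits.QuantumFields.YangMills.Theorems.ColdStartUniversalityLatticeLangevinMartingaleMaximal
import Summits.QuantumFields.YangMills.Theorems.ColdStartUniversalityLatticeLangevinPoissonEquation
import HarnessLib

/-!
# Route `ColdStartUniversality` (fixed-cut-off SZZ dynamics): ★★★ UNIFORM-IN-TIME HOEFFDING BAND FOR THE COLD-START SAMPLER —
# `P[∃ t ≤ T, |∫₀ᵗ (G(U_r) − μ_(β')G) dr| ≥ Tε] ≤ 2·exp(−c·T·ε²/(576·C))`: the running time-integral never deviates, same constant as file 70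

Helper file (seat `ym-line-csu-p1`, g34; `--supports stmt-QuantumFields-24809`).  File 70 bounds the deviation of the time average at the FINAL
time `T`; here the whole trajectory `t ↦ ∫₀ᵗ Ĝ(U_r) dr`, `0 ≤ t ≤ T` (`Ĝ = G − μ_(β')G`), is controlled simultaneously, WITH THE SAME CONSTANT:
the increments of the Poisson/Dynkin martingale (file 81) are orthogonal to their past, so the maximal Azuma–Hoeffding inequality of file 78
applies on the coarse grid `kh`, `h = T/⌈T/b⌉ ≤ b = 2β_u`, and between grid points the integral moves by at most `2h ≤ 2b`.
* ★★ `measureReal_exists_timeIntegral_ge_le_exp_of_corrector_of_prog` / `…_of_corrector` — generic (any bounded mild corrector `|u| ≤ β_u`):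
  `P[∃ t ∈ [0,T], |∫_(0,t] Ĝ(U_r) dr| ≥ Tε] ≤ 2·exp(−Tε²/(288 β_u))`, progressively measurable / EVERY strong solution from a deterministic start;
* ★★★ `measureReal_exists_timeIntegral_ge_le_exp` — with g16's corrector (`β_u = 2C/c`): **`≤ 2·exp(−c·T·ε²/(576·C))` for EVERY strong solution
  of the SU(2) SZZ dynamics from a deterministic start on ANY space, every continuous `|G| ≤ 1`, all `T, ε > 0`** — equivalently, with that
  probability the running averages obey `|t⁻¹∫₀ᵗ G(U_r)dr − μ_(β')G| < εT/t` for ALL `t ∈ (0, T]` at once.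
(The event `{∃ t ∈ [0,T], …}` need not be measurable; `P.real` is the outer measure and all steps are monotone.)  THEOREMS ONLY, no definition, no
sorry; [folklore] (maximal Azuma–Hoeffding).  HONEST FRAMING: fixed cut-off; `C, c` depend on `L, β'`; `UniformColdStartMixing` (24809) is NOT restated;
no crux, rung or summit statement is proved; the Yang–Mills mass gap is NOT proved.
-/

set_option autoImplicit false

noncomputable section

namespace Summit.QuantumFields.YangMills.Theorems.ColdStartUniversality

open MeasureTheory ProbabilityTheory Filter Topology Set
open scoped NNReal ENNReal BigOperators
open Literature Literature.Probability.Process Literature.MathematicalPhysics.QuantumFieldTheory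
open Literature.MathematicalPhysics.QuantumLattice (fundamentalRep fundamentalLatticeRep continuous_fundamentalRep)

variable {L : ℕ} [NeZero L]

/-- ★★ **Uniform-in-time Hoeffding band from a bounded corrector (progressively measurable solutions).**  For every realising kernel family `κ`,
continuous `|G| ≤ 1`, measurable corrector `u` with `|u| ≤ β_u` (`β_u > 0`) solving the mild Poisson equation for `Ĝ = G − μ_(β')G`, every
progressively measurable strong solution from a deterministic start on ANY space and all `T, ε > 0`:
`P[∃ t ∈ [0,T], |∫_(0,t] Ĝ(U_r) dr| ≥ T·ε] ≤ 2·exp(−T·ε²/(288·β_u))`. [folklore] -/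
theorem measureReal_exists_timeIntegral_ge_le_exp_of_corrector_of_prog (β' : ℝ)
    (κ : ℝ≥0 → Kernel (GaugeConfig 3 L (Matrix.specialUnitaryGroup (Fin 2) ℂ))
      (GaugeConfig 3 L (Matrix.specialUnitaryGroup (Fin 2) ℂ))) [∀ t, IsMarkovKernel (κ t)]
    (hreal : ∀ (t : ℝ≥0) (x : GaugeConfig 3 L (Matrix.specialUnitaryGroup (Fin 2) ℂ))
        (Ω : Type) [MeasurableSpace Ω] (P : Measure Ω) [IsProbabilityMeasure P]
        (W : ℝ≥0 → Ω → (Edge 3 L × NoiseIdx 2 → ℝ)) (hW : IsFlatBrownian W P)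
        (U : ℝ≥0 → Ω → GaugeConfig 3 L (Matrix.specialUnitaryGroup (Fin 2) ℂ)),
        (∀ ω, U 0 ω = x) →
        (latticeLangevinDynamics (fundamentalLatticeRep 2) β').IsSolution (fundamentalRep (Fin 2))
          hW.natFiltration P W U →
        κ t x = P.map (U t))
    {G : GaugeConfig 3 L (Matrix.specialUnitaryGroup (Fin 2) ℂ) → ℝ} (hG : Continuous G) (hG1 : ∀ z, |G z| ≤ 1)
    {u : GaugeConfig 3 L (Matrix.specialUnitaryGroup (Fin 2) ℂ) → ℝ} (hum : Measurable u) {βu : ℝ} (hβu : 0 < βu) (hu_b : ∀ y, |u y| ≤ βu)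
    (hPois : ∀ (s : ℝ≥0) (y : GaugeConfig 3 L (Matrix.specialUnitaryGroup (Fin 2) ℂ)),
      (∫ z, u z ∂(κ s y)) - u y = -∫ t in (0 : ℝ)..(s : ℝ),
        (∫ z, (G z - ∫ z', G z' ∂(wilsonMeasure (d := 3) (L := L) (fundamentalRep (Fin 2)) β')) ∂(κ t.toNNReal y)))
    (x : GaugeConfig 3 L (Matrix.specialUnitaryGroup (Fin 2) ℂ))
    {Ω : Type} [MeasurableSpace Ω] {P : Measure Ω} [IsProbabilityMeasure P]
    {W : ℝ≥0 → Ω → (Edge 3 L × NoiseIdx 2 → ℝ)} (hW : IsFlatBrownian W P)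
    {U : ℝ≥0 → Ω → GaugeConfig 3 L (Matrix.specialUnitaryGroup (Fin 2) ℂ)} (hU0 : ∀ ω, U 0 ω = x)
    (hU : (latticeLangevinDynamics (fundamentalLatticeRep 2) β').IsSolution (fundamentalRep (Fin 2)) hW.natFiltration P W U)
    (hprog : ∀ i : ℝ≥0, Measurable[@Prod.instMeasurableSpace (Set.Iic i) Ω inferInstance (hW.natFiltration i)]
      (fun q : Set.Iic i × Ω => U q.1 q.2))
    {T : ℝ} (hT : 0 < T) {ε : ℝ} (hε : 0 < ε) :
    P.real {ω | ∃ t ∈ Icc (0 : ℝ) T, T * ε ≤ |∫ r in Ioc (0 : ℝ) t,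
        (G (U r.toNNReal ω) - ∫ z', G z' ∂(wilsonMeasure (d := 3) (L := L) (fundamentalRep (Fin 2)) β'))|} ≤
      2 * Real.exp (-(T * ε ^ 2) / (288 * βu)) := by
  classical
  haveI := secondCountableTopology_su2
  haveI := borelSpace_config L
  haveI : IsProbabilityMeasure (wilsonMeasure (d := 3) (L := L) (fundamentalRep (Fin 2)) β') :=
    isProbabilityMeasure_wilsonMeasure (d := 3) (L := L) (fundamentalRep (Fin 2)) (continuous_fundamentalRep (Fin 2)) β'
  set m : ℝ := ∫ z', G z' ∂(wilsonMeasure (d := 3) (L := L) (fundamentalRep (Fin 2)) β') with hm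
  have hGm : Measurable G := hG.measurable
  have hm1 : |m| ≤ 1 := by
    have hh := norm_integral_le_of_norm_le_const (μ := wilsonMeasure (d := 3) (L := L) (fundamentalRep (Fin 2)) β') (f := G) (C := 1)
      (Eventually.of_forall fun z => by simpa [Real.norm_eq_abs] using hG1 z)
    simpa [Real.norm_eq_abs] using hh
  have hGhm : Measurable fun z => G z - m := hGm.sub measurable_const
  have hGhb : ∀ z, |G z - m| ≤ 2 := fun z => (abs_sub _ _).trans (by linarith [hG1 z, hm1])
  -- sections of the solution are measurable (progressive measurability)
  have hJ : Measurable fun q : Ω × ℝ => U q.2.toNNReal q.1 :=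
    measurable_uncurry_of_prog (Z := U) (fun n : ℕ => hW.natFiltration n) (fun n => hW.natFiltration.le n) (fun n => hprog n)
  have hsec : ∀ ω, Measurable fun r : ℝ => U r.toNNReal ω := fun ω => hJ.comp (measurable_const.prodMk measurable_id)
  have hii : ∀ ω (a a' : ℝ), IntervalIntegrable (fun r => G (U r.toNNReal ω) - m) volume a a' := fun ω a a' =>
    (intervalIntegrable_const (c := (2 : ℝ))).mono_fun' ((hGhm.comp (hsec ω)).aestronglyMeasurable)
      (ae_of_all _ fun r => by simp only [Real.norm_eq_abs]; exact hGhb _)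
  have hIb : ∀ ω (a a' : ℝ), a ≤ a' → |∫ r in Ioc a a', (G (U r.toNNReal ω) - m)| ≤ 2 * (a' - a) := fun ω a a' haa' => by
    have hh' := norm_setIntegral_le_of_norm_le_const (μ := volume) (s := Ioc a a') measure_Ioc_lt_top
      (fun r _ => show ‖G (U r.toNNReal ω) - m‖ ≤ 2 by rw [Real.norm_eq_abs]; exact hGhb _) (f := fun r => G (U r.toNNReal ω) - m)
    rwa [Real.norm_eq_abs, Real.volume_real_Ioc_of_le haa'] at hh'
  /- ### 0. `ε > 2`: the event is empty -/
  by_cases hε2 : 2 < ε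
  · have hempty : {ω | ∃ t ∈ Icc (0 : ℝ) T, T * ε ≤ |∫ r in Ioc (0 : ℝ) t, (G (U r.toNNReal ω) - m)|} = ∅ := by
      refine Set.eq_empty_iff_forall_notMem.2 fun ω hω => ?_
      obtain ⟨t, ht, hω⟩ := hω
      have h1 := hIb ω 0 t ht.1
      nlinarith [ht.2]
    rw [hempty, measureReal_empty]
    positivity
  push Not at hε2
  /- ### 1. The coarse grid and the increments of file 81 -/
  set b : ℝ := 2 * βu with hb
  have hb0 : 0 < b := by positivity
  set N : ℕ := ⌈T / b⌉₊ with hN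
  have hTb : 0 < T / b := div_pos hT hb0
  have hN0 : 0 < N := Nat.ceil_pos.2 hTb
  have hNr : (0 : ℝ) < N := by exact_mod_cast hN0
  have hNge : T / b ≤ N := Nat.le_ceil _
  have hNlt : (N : ℝ) < T / b + 1 := Nat.ceil_lt_add_one hTb.le
  set h : ℝ := T / N with hh
  have hh0 : 0 < h := div_pos hT hNr
  have hhb : h ≤ b := by
    rw [hh, div_le_iff₀ hNr]
    calc T = T / b * b := by field_simp
      _ ≤ N * b := by gcongr
      _ = b * N := mul_comm _ _
  have hNh : (N : ℝ) * h = T := by rw [hh]; field_simp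
  obtain ⟨D, hDF, hDb, horth, hsum⟩ := exists_correctorIncrements β' κ hreal hG hG1 hum hu_b hPois x hW hU0 hU hprog hh0
  set B : ℝ := 2 * βu + 2 * h with hB
  have hB0 : 0 < B := by positivity
  /- ### 2. Maximal Azuma–Hoeffding on the grid (file 78) -/
  have hℱmono : Monotone fun k : ℕ => hW.natFiltration ((k : ℝ) * h).toNNReal := fun j k hjk =>
    hW.natFiltration.mono (Real.toNNReal_le_toNNReal (mul_le_mul_of_nonneg_right (by exact_mod_cast hjk) hh0.le))
  have htail : ∀ {r : ℝ}, 0 ≤ r → P.real {ω | ∃ k, k ≤ N ∧ r ≤ |∑ i ∈ Finset.range k, D i ω|} ≤ 2 * Real.exp (-r ^ 2 / (2 * (N * B ^ 2))) :=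
    fun {r} hr => measureReal_exists_abs_sum_ge_le_of_orthogonal (fun k : ℕ => hW.natFiltration ((k : ℝ) * h).toNNReal)
      (fun k => hW.natFiltration.le _) hℱmono D hDF hB0 hDb N (fun k _ => horth k) hr
  /- ### 3. Every `t ≤ T` is within `h` of a grid point: event inclusion -/
  have hincl : {ω | ∃ t ∈ Icc (0 : ℝ) T, T * ε ≤ |∫ r in Ioc (0 : ℝ) t, (G (U r.toNNReal ω) - m)|} ⊆
      {ω | ∃ k, k ≤ N ∧ T * ε - 3 * b ≤ |∑ i ∈ Finset.range k, D i ω|} := by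
    rintro ω ⟨t, ht, hω⟩
    set k : ℕ := ⌊t / h⌋₊ with hk
    have hth : 0 ≤ t / h := div_nonneg ht.1 hh0.le
    have hkN : k ≤ N := Nat.floor_le_of_le (by rw [div_le_iff₀ hh0, hNh]; exact ht.2)
    have hkt : (k : ℝ) * h ≤ t := by
      have := Nat.floor_le hth
      rwa [le_div_iff₀ hh0] at this
    have htk : t - k * h ≤ h := by
      have h1 := Nat.lt_floor_add_one (t / h)
      rw [div_lt_iff₀ hh0] at h1
      rw [← hk] at h1
      linarith
    refine ⟨k, hkN, ?_⟩
    -- `I_t = I_(kh) + ∫_(kh,t]`, `I_(kh) = S_k − u(U_(kh)) + u(x)`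
    have hsplit : ∫ r in Ioc (0 : ℝ) t, (G (U r.toNNReal ω) - m) =
        (∫ r in Ioc (0 : ℝ) (k * h), (G (U r.toNNReal ω) - m)) + ∫ r in Ioc ((k : ℝ) * h) t, (G (U r.toNNReal ω) - m) := by
      have hk0 : (0 : ℝ) ≤ (k : ℝ) * h := by positivity
      rw [← intervalIntegral.integral_of_le ht.1, ← intervalIntegral.integral_of_le hk0, ← intervalIntegral.integral_of_le hkt,
        intervalIntegral.integral_add_adjacent_intervals (hii ω _ _) (hii ω _ _)]
    have hSk := hsum k ω
    have h1 := hIb ω ((k : ℝ) * h) t hkt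
    have h2 : |∫ r in Ioc (0 : ℝ) (k * h), (G (U r.toNNReal ω) - m)| ≤ |∑ i ∈ Finset.range k, D i ω| + b := by
      have heq : ∫ r in Ioc (0 : ℝ) (k * h), (G (U r.toNNReal ω) - m) =
          (∑ i ∈ Finset.range k, D i ω) - (u (U (((k : ℝ) * h).toNNReal) ω) - u x) := by rw [hSk]; ring
      rw [heq]
      exact (abs_sub _ _).trans (add_le_add le_rfl ((abs_sub _ _).trans (by linarith [hu_b (U (((k : ℝ) * h).toNNReal) ω), hu_b x])))
    rw [hsplit] at hω
    have h3 := abs_add_le (∫ r in Ioc (0 : ℝ) (k * h), (G (U r.toNNReal ω) - m)) (∫ r in Ioc ((k : ℝ) * h) t, (G (U r.toNNReal ω) - m))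
    linarith
  /- ### 4. Arithmetic -/
  have hKb : T * ε ^ 2 / (288 * βu) = T * ε ^ 2 / (144 * b) := by rw [hb]; ring
  have hRHS1 : ∀ {y : ℝ}, y ≤ 1 / 12 → (1 : ℝ) ≤ 2 * Real.exp (-y) := fun {y} hy => by
    have h1 := Real.add_one_le_exp (-y)
    linarith
  by_cases hbig : b ≤ T ∧ 6 * b ≤ T * ε
  · obtain ⟨hbT, hbTε⟩ := hbig
    have hr : 0 ≤ T * ε - 3 * b := by linarith
    refine (measureReal_mono hincl).trans ((htail hr).trans ?_)
    refine mul_le_mul_of_nonneg_left (Real.exp_le_exp.2 ?_) (by norm_num)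
    rw [neg_div, neg_div, neg_le_neg_iff, hKb]
    have hB3 : B ≤ 3 * b := by rw [hB, hb]; linarith
    have hNb : (N : ℝ) * b ≤ T + b := by
      have h1 := mul_lt_mul_of_pos_right hNlt hb0
      rw [add_mul, div_mul_cancel₀ _ hb0.ne', one_mul] at h1
      exact h1.le
    have hden : 2 * (N * B ^ 2) ≤ 36 * b * T := by
      calc 2 * (N * B ^ 2) ≤ 2 * (N * (3 * b) ^ 2) := by gcongr
        _ = 18 * b * (N * b) := by ring
        _ ≤ 18 * b * (T + b) := by gcongr
        _ ≤ 18 * b * (T + T) := by gcongr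
        _ = 36 * b * T := by ring
    have hden0 : 0 < 2 * (N * B ^ 2) := by positivity
    have hnum : T ^ 2 * ε ^ 2 / 4 ≤ (T * ε - 3 * b) ^ 2 := by nlinarith
    calc T * ε ^ 2 / (144 * b) = (T ^ 2 * ε ^ 2 / 4) / (36 * b * T) := by
          rw [div_eq_div_iff (by positivity) (by positivity)]
          ring
      _ ≤ (T ^ 2 * ε ^ 2 / 4) / (2 * (N * B ^ 2)) := div_le_div_of_nonneg_left (by positivity) hden0 hden
      _ ≤ (T * ε - 3 * b) ^ 2 / (2 * (N * B ^ 2)) := div_le_div_of_nonneg_right hnum hden0.le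
  · have hTε2 : T * ε ^ 2 < 12 * b := by
      rcases not_and_or.1 hbig with h1 | h1
      · push Not at h1
        calc T * ε ^ 2 ≤ T * 2 ^ 2 := by gcongr
          _ < b * 2 ^ 2 := by gcongr
          _ = 4 * b := by ring
          _ ≤ 12 * b := by linarith
      · push Not at h1
        calc T * ε ^ 2 = (T * ε) * ε := by ring
          _ ≤ (T * ε) * 2 := by gcongr
          _ < (6 * b) * 2 := by gcongr
          _ = 12 * b := by ring
    refine measureReal_le_one.trans ?_
    rw [neg_div, hKb]
    refine hRHS1 ?_
    rw [div_le_div_iff₀ (by positivity) (by norm_num)]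
    linarith

/-- ★★ **Uniform-in-time Hoeffding band from a bounded corrector (EVERY strong solution)** — as `…_of_corrector_of_prog`, by the regular flow and
pathwise uniqueness. [folklore] -/
theorem measureReal_exists_timeIntegral_ge_le_exp_of_corrector (β' : ℝ)
    (κ : ℝ≥0 → Kernel (GaugeConfig 3 L (Matrix.specialUnitaryGroup (Fin 2) ℂ))
      (GaugeConfig 3 L (Matrix.specialUnitaryGroup (Fin 2) ℂ))) [∀ t, IsMarkovKernel (κ t)]
    (hreal : ∀ (t : ℝ≥0) (x : GaugeConfig 3 L (Matrix.specialUnitaryGroup (Fin 2) ℂ))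
        (Ω : Type) [MeasurableSpace Ω] (P : Measure Ω) [IsProbabilityMeasure P]
        (W : ℝ≥0 → Ω → (Edge 3 L × NoiseIdx 2 → ℝ)) (hW : IsFlatBrownian W P)
        (U : ℝ≥0 → Ω → GaugeConfig 3 L (Matrix.specialUnitaryGroup (Fin 2) ℂ)),
        (∀ ω, U 0 ω = x) →
        (latticeLangevinDynamics (fundamentalLatticeRep 2) β').IsSolution (fundamentalRep (Fin 2))
          hW.natFiltration P W U →
        κ t x = P.map (U t))
    {G : GaugeConfig 3 L (Matrix.specialUnitaryGroup (Fin 2) ℂ) → ℝ} (hG : Continuous G) (hG1 : ∀ z, |G z| ≤ 1)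
    {u : GaugeConfig 3 L (Matrix.specialUnitaryGroup (Fin 2) ℂ) → ℝ} (hum : Measurable u) {βu : ℝ} (hβu : 0 < βu) (hu_b : ∀ y, |u y| ≤ βu)
    (hPois : ∀ (s : ℝ≥0) (y : GaugeConfig 3 L (Matrix.specialUnitaryGroup (Fin 2) ℂ)),
      (∫ z, u z ∂(κ s y)) - u y = -∫ t in (0 : ℝ)..(s : ℝ),
        (∫ z, (G z - ∫ z', G z' ∂(wilsonMeasure (d := 3) (L := L) (fundamentalRep (Fin 2)) β')) ∂(κ t.toNNReal y)))
    (x : GaugeConfig 3 L (Matrix.specialUnitaryGroup (Fin 2) ℂ))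
    {Ω : Type} [MeasurableSpace Ω] {P : Measure Ω} [IsProbabilityMeasure P]
    {W : ℝ≥0 → Ω → (Edge 3 L × NoiseIdx 2 → ℝ)} (hW : IsFlatBrownian W P)
    {U : ℝ≥0 → Ω → GaugeConfig 3 L (Matrix.specialUnitaryGroup (Fin 2) ℂ)} (hU0 : ∀ ω, U 0 ω = x)
    (hU : (latticeLangevinDynamics (fundamentalLatticeRep 2) β').IsSolution (fundamentalRep (Fin 2)) hW.natFiltration P W U)
    {T : ℝ} (hT : 0 < T) {ε : ℝ} (hε : 0 < ε) :
    P.real {ω | ∃ t ∈ Icc (0 : ℝ) T, T * ε ≤ |∫ r in Ioc (0 : ℝ) t,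
        (G (U r.toNNReal ω) - ∫ z', G z' ∂(wilsonMeasure (d := 3) (L := L) (fundamentalRep (Fin 2)) β'))|} ≤
      2 * Real.exp (-(T * ε ^ 2) / (288 * βu)) := by
  classical
  obtain ⟨V, -, hV, hVprog, -, -, -⟩ := exists_regularFlow L β' hW
  have hprog : ∀ i : ℝ≥0, Measurable[@Prod.instMeasurableSpace (Set.Iic i) Ω inferInstance (hW.natFiltration i)]
      (fun q : Set.Iic i × Ω => V x q.1 q.2) := fun i =>
    (hVprog i).comp (measurable_fst.prodMk (measurable_const.prodMk measurable_snd))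
  have hmain := measureReal_exists_timeIntegral_ge_le_exp_of_corrector_of_prog β' κ hreal hG hG1 hum hβu hu_b hPois x hW (hV x).1 (hV x).2
    hprog hT hε
  have hae := latticeLangevin_pathwise_unique hW β' x hU0 (hV x).1 hU (hV x).2
  have hset : {ω | ∃ t ∈ Icc (0 : ℝ) T, T * ε ≤ |∫ r in Ioc (0 : ℝ) t,
        (G (U r.toNNReal ω) - ∫ z', G z' ∂(wilsonMeasure (d := 3) (L := L) (fundamentalRep (Fin 2)) β'))|} =ᵐ[P]
      {ω | ∃ t ∈ Icc (0 : ℝ) T, T * ε ≤ |∫ r in Ioc (0 : ℝ) t,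
        (G (V x r.toNNReal ω) - ∫ z', G z' ∂(wilsonMeasure (d := 3) (L := L) (fundamentalRep (Fin 2)) β'))|} := by
    refine Filter.eventuallyEq_set.2 ?_
    filter_upwards [hae] with ω hω
    have hfun : (fun r : ℝ => G (U r.toNNReal ω) - ∫ z', G z' ∂(wilsonMeasure (d := 3) (L := L) (fundamentalRep (Fin 2)) β')) =
        fun r : ℝ => G (V x r.toNNReal ω) - ∫ z', G z' ∂(wilsonMeasure (d := 3) (L := L) (fundamentalRep (Fin 2)) β') :=
      funext fun r => by rw [hω]
    simp only [hfun]
  rw [measureReal_congr hset]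
  exact hmain

/-- ★★★ **UNIFORM-IN-TIME HOEFFDING BAND FOR THE COLD-START LANGEVIN SAMPLER** (every coupling, every start, every realisation; `C, c` depend
on `L, β'`): there are `C, c > 0` such that for EVERY strong solution `U` of the SU(2) SZZ dynamics from a deterministic start on ANY probability
space, every continuous `G` with `|G| ≤ 1` and ALL `T > 0`, `ε > 0`:
`P[ ∃ t ∈ [0,T], |∫_(0,t] (G(U_r) − μ_(β')G) dr| ≥ T·ε ] ≤ 2 · exp(−c·T·ε² / (576·C))` — the same bound as for the final time alone
(`measureReal_timeAverage_deviation_le_exp`). [folklore] -/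
theorem measureReal_exists_timeIntegral_ge_le_exp (L : ℕ) [NeZero L] (β' : ℝ) :
    ∃ C c : ℝ, 0 < C ∧ 0 < c ∧
      ∀ (x : GaugeConfig 3 L (Matrix.specialUnitaryGroup (Fin 2) ℂ))
        (Ω : Type) [MeasurableSpace Ω] (P : Measure Ω) [IsProbabilityMeasure P]
        (W : ℝ≥0 → Ω → (Edge 3 L × NoiseIdx 2 → ℝ)) (hW : IsFlatBrownian W P)
        (U : ℝ≥0 → Ω → GaugeConfig 3 L (Matrix.specialUnitaryGroup (Fin 2) ℂ)),
        (∀ ω, U 0 ω = x) →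
        (latticeLangevinDynamics (fundamentalLatticeRep 2) β').IsSolution (fundamentalRep (Fin 2)) hW.natFiltration P W U →
        ∀ (G : GaugeConfig 3 L (Matrix.specialUnitaryGroup (Fin 2) ℂ) → ℝ), Continuous G → (∀ z, |G z| ≤ 1) →
        ∀ (T : ℝ), 0 < T → ∀ (ε : ℝ), 0 < ε →
          P.real {ω | ∃ t ∈ Icc (0 : ℝ) T, T * ε ≤ |∫ r in Ioc (0 : ℝ) t,
              (G (U r.toNNReal ω) - ∫ z', G z' ∂(wilsonMeasure (d := 3) (L := L) (fundamentalRep (Fin 2)) β'))|} ≤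
            2 * Real.exp (-(c * T * ε ^ 2) / (576 * C)) := by
  classical
  haveI := secondCountableTopology_su2
  haveI := borelSpace_config L
  haveI : IsProbabilityMeasure (wilsonMeasure (d := 3) (L := L) (fundamentalRep (Fin 2)) β') :=
    isProbabilityMeasure_wilsonMeasure (d := 3) (L := L) (fundamentalRep (Fin 2)) (continuous_fundamentalRep (Fin 2)) β'
  obtain ⟨C, c, hC, hc, hP⟩ := exists_poisson_solution L β'
  refine ⟨C, c, hC, hc, fun x Ω _ P _ W hW U hU0 hU G hG hG1 T hT ε hε => ?_⟩
  obtain ⟨κ, hκM, -, hreal⟩ := exists_transitionKernel L β'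
  haveI := hκM
  set m : ℝ := ∫ z', G z' ∂(wilsonMeasure (d := 3) (L := L) (fundamentalRep (Fin 2)) β') with hm
  have hm1 : |m| ≤ 1 := by
    have hh := norm_integral_le_of_norm_le_const (μ := wilsonMeasure (d := 3) (L := L) (fundamentalRep (Fin 2)) β') (f := G) (C := 1)
      (Eventually.of_forall fun z => by simpa [Real.norm_eq_abs] using hG1 z)
    simpa [Real.norm_eq_abs] using hh
  have hGhc : Continuous fun z => G z - m := hG.sub continuous_const
  have hGhb : ∀ z, |G z - m| ≤ 2 := fun z => (abs_sub _ _).trans (by linarith [hG1 z, hm1])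
  have hGh0 : ∫ z, (G z - m) ∂(wilsonMeasure (d := 3) (L := L) (fundamentalRep (Fin 2)) β') = 0 := by
    have hGi : Integrable G (wilsonMeasure (d := 3) (L := L) (fundamentalRep (Fin 2)) β') :=
      (integrable_const (1 : ℝ)).mono' hG.measurable.aestronglyMeasurable (Eventually.of_forall fun z => by simpa [Real.norm_eq_abs] using hG1 z)
    rw [integral_sub hGi (integrable_const m), integral_const, smul_eq_mul, probReal_univ, one_mul, hm, sub_self]
  obtain ⟨u, hu_c, -, hu_b, -, hPois⟩ := hP κ hreal (fun z => G z - m) hGhc hGh0 2 hGhb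
  have hβu : (0 : ℝ) < 2 * C / c := by positivity
  have hmain := measureReal_exists_timeIntegral_ge_le_exp_of_corrector β' κ hreal hG hG1 hu_c.measurable hβu hu_b hPois x hW hU0 hU hT hε
  refine hmain.trans (le_of_eq ?_)
  congr 2
  field_simp
  ring

end Summit.QuantumFields.YangMills.Theorems.ColdStartUniversality

end
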